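import Mathlib
import Literature.Probability.LatticeModels.LatticeGraph

/-!
# Sketch — first lemmas of the three crux-idea cards for `NodalWardXY.PerturbedXYOrder`
(crux item stmt-HubbardSuperconductivity-10739; crux-ideate round 1, ideator 3).

Statements only (`def … : Prop`); nothing here is proposed to the tree.
-/

noncomputable section

namespace Summit.HubbardSuperconductivity.HubbardSuperconductivity.Cruxes.PerturbedXYOrder.IdeaSketch

open MeasureTheory Literature.Probability.LatticeModels

/-! ## Card A — `leray-sectorial-absorption` -/

/-- A1. Schur-test relative bound: an admissible kernel is a contraction of size `ε S` on
`ℓ²(bonds)`, hence the quadratic tilt is RELATIVELY BOUNDED by the spin-wave energy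
`Σ_b v_b²` (take `v_b = sin ∇_bθ`; `sin² ≤ 2(1 - cos)`). `S` = any bound on the row sums of
`(1+dist)⁻⁴` (≤ 3 · 2.4572 uniformly in `L`). Provable now. -/
def SchurRelativeBound : Prop :=
  ∀ (L : ℕ) [NeZero L] (ε S : ℝ)
    (K : (TorusSite 3 L × Fin 3) → (TorusSite 3 L × Fin 3) → ℂ),
    (∀ b b', ‖K b b'‖ ≤ ε / (1 + ((torusGraph 3 L).dist b.1 b'.1 : ℝ)) ^ 4) →
    (∀ b : TorusSite 3 L × Fin 3,
        ∑ b' : TorusSite 3 L × Fin 3, 1 / (1 + ((torusGraph 3 L).dist b.1 b'.1 : ℝ)) ^ 4 ≤ S) →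
    ∀ v : (TorusSite 3 L × Fin 3) → ℝ,
      ‖∑ b, ∑ b', K b b' * (v b : ℂ) * (v b' : ℂ)‖ ≤ ε * S * ∑ b, v b ^ 2

/-- A2. Sectorial Gaussian integrals do not vanish (the dimension-free Gaussian caricature of
`Z_K ≠ 0`): if `A` is a real positive-definite form and the complex form `B` is dominated by
`κ A` with `κ < 1`, then `∫_{ℝⁿ} exp(-½ θᵀ(A - B)θ) dθ ≠ 0` (it equals
`(2π)^{n/2} det(A - B_sym)^{-1/2}`, and `Re (A - B_sym) ≥ (1-κ)A > 0` makes `A - B_sym`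
invertible). Provable now (analytic continuation in `B`, or diagonalisation of `A`). -/
def SectorialGaussianNonvanishing : Prop :=
  ∀ (n : ℕ) (A : Matrix (Fin n) (Fin n) ℝ) (B : Matrix (Fin n) (Fin n) ℂ) (κ : ℝ),
    A.PosDef → 0 ≤ κ → κ < 1 →
    (∀ v : Fin n → ℝ, ‖∑ i, ∑ j, B i j * (v i : ℂ) * (v j : ℂ)‖ ≤ κ * ∑ i, ∑ j, A i j * v i * v j) →
    (∫ θ : Fin n → ℝ,
        Complex.exp (-(1 / 2 : ℂ) * ∑ i, ∑ j, (((A i j : ℝ) : ℂ) - B i j) * (θ i : ℂ) * (θ j : ℂ)))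
      ≠ 0

/-! ## Card B — `bessel-current-duality` -/

/-- B1. The exact current duality on one bond (integration by parts of
`d/dφ e^{J cos φ} = -J sin φ e^{J cos φ}` against `e^{-inφ}` over a period): the `n`-th Fourier
coefficient of `sin φ · e^{J cos φ}` is `n/(iJ)` times that of `e^{J cos φ}` (`= 2π I_n(J)`), i.e.
in the divergence-free integer-current (Bessel/worm) representation of the plane rotator the bond
current `sin ∇_bθ` is EXACTLY the dual integer current `N_b/(iJ)` (Bessel recurrence
`I_{n-1} - I_{n+1} = (2n/J) I_n`). Provable now. -/
def BesselCurrentIdentity : Prop :=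
  ∀ (J : ℝ), J ≠ 0 → ∀ n : ℤ,
    (∫ φ in (0 : ℝ)..(2 * Real.pi),
        ((Real.exp (J * Real.cos φ) * Real.sin φ : ℝ) : ℂ) *
          Complex.exp (-(Complex.I * (n : ℂ) * (φ : ℂ))))
      = ((n : ℂ) / (Complex.I * (J : ℂ))) *
        ∫ φ in (0 : ℝ)..(2 * Real.pi),
          ((Real.exp (J * Real.cos φ) : ℝ) : ℂ) * Complex.exp (-(Complex.I * (n : ℂ) * (φ : ℂ)))

/-- B2. The same identity in "annealed bond-angle" form: the first moment of `sin` under the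
complex single-bond weight `ρ_N(φ) = e^{J cos φ - iNφ}` is `N/(iJ)` times its mass. -/
def BesselCurrentFirstMoment : Prop :=
  ∀ (J : ℝ), J ≠ 0 → ∀ N : ℤ,
    (∫ φ in (0 : ℝ)..(2 * Real.pi),
        (Real.sin φ : ℂ) * Complex.exp ((J * Real.cos φ : ℝ) - Complex.I * (N : ℂ) * (φ : ℂ)))
      = ((N : ℂ) / (Complex.I * (J : ℂ))) *
        ∫ φ in (0 : ℝ)..(2 * Real.pi),
          Complex.exp ((J * Real.cos φ : ℝ) - Complex.I * (N : ℂ) * (φ : ℂ))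

/-! ## Card C — `ward-peeling-transfer` -/

/-- C1. The rotator WARD IDENTITY on the torus of angles (shift symmetry `θ ↦ θ + χ`;
integration by parts in the coordinate `θ_x` over one period, boundary terms cancelling by
periodicity): for a `C¹`, `2π`-periodic-in-`θ_x` observable `F`,
`∫ ∂_{θ_x}F · w_J = -J ∫ F · (Σ_i [j_{(x,i)} - j_{(x-e_i,i)}]) · w_J`, i.e. the lattice
divergence of the current inserted at `x` is a CONTACT TERM `J⁻¹ ∂_{θ_x}`. This is what peels
every longitudinal current leg of a cumulant into `∇Δ⁻¹ ∘ (local derivative insertion)`. -/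
def RotatorWardIdentity : Prop :=
  ∀ (L : ℕ) [NeZero L] (J : ℝ) (x : TorusSite 3 L) (F : (TorusSite 3 L → ℝ) → ℂ),
    ContDiff ℝ 1 F → (∀ θ, F (θ + (2 * Real.pi) • Pi.single x 1) = F θ) →
    let cube : Set (TorusSite 3 L → ℝ) := Set.pi Set.univ (fun _ => Set.Icc (0 : ℝ) (2 * Real.pi))
    let cur : (TorusSite 3 L × Fin 3) → (TorusSite 3 L → ℝ) → ℝ :=
      fun b θ => Real.sin (θ (b.1 + Pi.single b.2 1) - θ b.1)
    let wJ : (TorusSite 3 L → ℝ) → ℂ := fun θ =>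
      ((Real.exp (J * ∑ b : TorusSite 3 L × Fin 3,
          Real.cos (θ (b.1 + Pi.single b.2 1) - θ b.1)) : ℝ) : ℂ)
    (∫ θ in cube, lineDeriv ℝ F θ (Pi.single x 1) * wJ θ)
      = -(J : ℂ) * ∫ θ in cube,
          F θ * ((∑ i : Fin 3, (cur (x, i) θ - cur (x - Pi.single i 1, i) θ) : ℝ) : ℂ) * wJ θ

/-- C2. The complex-analysis half of the transfer (finite, provable now): an entire function with
`f 0 = 1` whose logarithmic Taylor coefficients obey `|(log f)^{(n)}(0)| ≤ n! Cⁿ V` with `C < 1`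
has no zero in the closed unit disc (the series of `log f` converges on `|t| < 1/C ⊃ closed unit
disc`, and `exp ∘ (that series) = f` there by the identity theorem). Applied with
`f(t) = ⟨e^{tW}⟩_J` this turns VOLUME-ORDER cumulant bounds under the POSITIVE pure measure
into `Z_K ≠ 0`; the same series for the `cos(θ_x-θ_y)` insertion gives plateau stability. -/
def ZeroFreeOfLogTaylorBounds : Prop :=
  ∀ (f : ℂ → ℂ), Differentiable ℂ f → f 0 = 1 →
    ∀ C V : ℝ, 0 ≤ C → C < 1 → 0 ≤ V →
    (∀ n : ℕ, 1 ≤ n →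
        ‖iteratedDeriv n (fun t => Complex.log (f t)) 0‖ ≤ n.factorial * C ^ n * V) →
    ∀ t : ℂ, ‖t‖ ≤ 1 → f t ≠ 0

/-- C3. TRANSFER TARGET `C⁺` (typed; the statement the line proves INSTEAD of the crux, all
expectations being under the POSITIVE pure rotator measure): volume-order Gevrey-1 bounds for the
logarithmic Taylor coefficients in the tilt strength `t` at `t = 0` — i.e. for the joint
cumulants of the current bilinear `W_K` (and of `W_K` with one `cos(θ_x - θ_y)` insertion) — for
kernels admissible with `ε = 1`, together with the unperturbed plateau for ALL `L ≥ 2`.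
`C⁺ → PerturbedXYOrder` (with `ε < 1/C` small against `a₀`) is C2 plus bookkeeping. -/
def PureRotatorCurrentCumulantBounds : Prop :=
  ∃ J₀ C a₀ : ℝ, 0 < C ∧ 0 < a₀ ∧ ∀ J : ℝ, J₀ ≤ J → ∀ (L : ℕ) [NeZero L], 2 ≤ L →
    ∀ K : (TorusSite 3 L × Fin 3) → (TorusSite 3 L × Fin 3) → ℂ,
    (∀ b b', ‖K b b'‖ ≤ 1 / (1 + ((torusGraph 3 L).dist b.1 b'.1 : ℝ)) ^ 4) →
    let cube : Set (TorusSite 3 L → ℝ) := Set.pi Set.univ (fun _ => Set.Icc (0 : ℝ) (2 * Real.pi))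
    let cur : (TorusSite 3 L × Fin 3) → (TorusSite 3 L → ℝ) → ℝ :=
      fun b θ => Real.sin (θ (b.1 + Pi.single b.2 1) - θ b.1)
    let wJ : (TorusSite 3 L → ℝ) → ℂ := fun θ =>
      ((Real.exp (J * ∑ b : TorusSite 3 L × Fin 3,
          Real.cos (θ (b.1 + Pi.single b.2 1) - θ b.1)) : ℝ) : ℂ)
    let W : (TorusSite 3 L → ℝ) → ℂ := fun θ => ∑ b, ∑ b', K b b' * (cur b θ : ℂ) * (cur b' θ : ℂ)
    let m : ℂ → ℂ := fun t => ∫ θ in cube, wJ θ * Complex.exp (t * W θ)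
    let q : ℂ → ℂ := fun t =>
      (∑ x : TorusSite 3 L, ∑ y : TorusSite 3 L,
          ∫ θ in cube, (Real.cos (θ x - θ y) : ℂ) * (wJ θ * Complex.exp (t * W θ))) / m t /
        ((L : ℂ) ^ 6)
    a₀ ≤ (q 0).re ∧
    ∀ n : ℕ, 1 ≤ n →
      ‖iteratedDeriv n (fun t => Complex.log (m t / m 0)) 0‖ ≤ n.factorial * C ^ n * (L : ℝ) ^ 3 ∧
      ‖iteratedDeriv n q 0‖ ≤ n.factorial * C ^ n

end Summit.HubbardSuperconductivity.HubbardSuperconductivity.Cruxes.PerturbedXYOrder.IdeaSketch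

end
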